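import Summits.AtomisticToContinuum.Crystallization.Theorems.ChartedZeroExcessLayeredLatticeLiouvilleZZZYRCVL

/-!
# Charted zero-excess layered-lattice Liouville — ZZZYRCVM: SOUNDNESS of the king-table program, II (one row)

Cell `decomp-a2c`, lens 2, generation 99.  Part II of the soundness of «ZZZYRCVK» (see ZZZYRCVL for the setting): ONE ROW.

* `xiRowAdd K HI1 HI2 x y mA mB j` — the SPEC of what `xiRowBins` adds at bin `j` (codes written through `code3` of the five step types), and
  `xiRowBins_getD`: `(xiRowBins … bins).length = 27`, `(xiRowBins … bins)[j] = bins[j] + xiRowAdd … j` (eight `xiAddAt` read-backs; every code `< 27`);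
* `member_bound_pos / _neg / _zero`: for a member `(x, y, ±n)` / `(x, y, 0)`, `kcnt · xiCoef ≤` its share of the row sums at bin `code3 δ`
  (`kcnt_iv3` + the indicator monotonicity `[δ' = δ] ≤ [code3 δ = code3 δ']` — no injectivity of the code is needed);
* ★ `xiRowC_sound`: if `xiRowC K HI1 HI2 x y mA mB bins = some bins'` then `bins'.length = 27` and for EVERY finite `S ⊆ ℤ` of third coordinates
  with `xiMember HI1 HI2 (x, y, m)` and every `δ`: `bins[code3 δ] + Σ_{m ∈ S} kcnt (x,y,m) δ · xiCoef K (x,y,m) ≤ bins'[code3 δ]`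
  (split `S` into `m = 0` / `m > 0` / `m < 0`, embed the signed parts into `mA + range (mB + 1 − mA)` by `xiMember_row`, sum the member bounds,
  regroup with `xiRowSums_eq`).

Theorem file (2 defs, 12 theorems); imports ZZZYRCVL; no instance / notation / option; 0 sorry. [g99]
-/

namespace Summit.AtomisticToContinuum.Crystallization.Theorems.ChartedZeroExcessLayeredLatticeLiouville

open scoped BigOperators

/-! ### §6 Soundness of one row -/

/-- indicator `[j = k]` (bin `j` read after an add at `k`). [g99] -/
def xiInd (k j : ℕ) : ℕ := if j = k then 1 else 0

/-- `xiAddAt` at a valid index, in indicator form. [g99] -/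
theorem getD_xiAddAt' {bs : List ℕ} {k : ℕ} (hk : k < bs.length) (c j : ℕ) :
    (xiAddAt bs k c).getD j 0 = bs.getD j 0 + c * xiInd k j := by
  rw [getD_xiAddAt]; unfold xiInd
  by_cases h : j = k
  · rw [if_pos ⟨h, hk⟩, if_pos h, mul_one]
  · rw [if_neg (fun h' => h h'.1), if_neg h, mul_zero]

/-- equal steps have equal codes: `[δ' = δ] ≤ [code3 δ = code3 δ']`. [g99] -/
theorem ite_le_xiInd (δ' δ : Cell 2 × ℤ) : (if δ' = δ then 1 else 0) ≤ xiInd (code3 δ') (code3 δ) := by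
  unfold xiInd
  by_cases h : δ' = δ
  · subst h; simp
  · rw [if_neg h]; exact Nat.zero_le _

/-- `sign` is in `[-1, 1]`. [g99] -/
theorem sign_mem (z : ℤ) : -1 ≤ Int.sign z ∧ Int.sign z ≤ 1 := by
  rcases lt_trichotomy z 0 with h | h | h
  · rw [Int.sign_eq_neg_one_of_neg h]; omega
  · rw [h, Int.sign_zero]; omega
  · rw [Int.sign_eq_one_of_pos h]; omega

/-- codes of steps are `< 27`. [g99] -/
theorem xiDcode_lt {d0 d1 d2 : ℤ} (h0 : -1 ≤ d0 ∧ d0 ≤ 1) (h1 : -1 ≤ d1 ∧ d1 ≤ 1) (h2 : -1 ≤ d2 ∧ d2 ≤ 1) :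
    xiDcode d0 d1 d2 < 27 := by
  unfold xiDcode; omega

/-- code of an `iv3`. [g99] -/
theorem code3_iv3 (a b c : ℤ) : code3 (iv3 a b c) = xiDcode a b c := by simp [code3]

/-- code of `dl1` = the program's `c1`. [g99] -/
theorem code3_dl1 (x y : ℤ) :
    code3 (dl1 x y) = if y.natAbs ≤ x.natAbs then xiDcode (Int.sign x) 0 0 else xiDcode 0 (Int.sign y) 0 := by
  unfold dl1; split_ifs <;> simp [code3]

/-- code of `dl2` = the program's `c2u / c2d`. [g99] -/
theorem code3_dl2 (x y σ : ℤ) :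
    code3 (dl2 x y σ) = if y.natAbs ≤ x.natAbs then xiDcode (Int.sign x) 0 σ else xiDcode 0 (Int.sign y) σ := by
  unfold dl2; split_ifs <;> simp [code3]

/-- ★ THE ROW'S ADDED AMOUNT at bin `j` (spec of `xiRowBins`, codes written through `code3`). [g99] -/
noncomputable def xiRowAdd (K HI1 HI2 : ℕ) (x y : ℤ) (mA mB j : ℕ) : ℕ :=
  let p := min x.natAbs y.natAbs
  let q := max x.natAbs y.natAbs
  let c0 := (K * q + xiQ0 x y ^ 4 - 1) / xiQ0 x y ^ 4
  let s := xiRowSums K (xiQmn x y) p q mA (mB + 1 - mA)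
  (if HI1 < xiQ0 x y ∧ xiQ0 x y ≤ HI2 ∧ ¬(x = 0 ∧ y = 0) then
      p * c0 * xiInd (code3 (iv3 (Int.sign x) (Int.sign y) 0)) j + (q - p) * c0 * xiInd (code3 (dl1 x y)) j else 0) +
    s.1 * xiInd (code3 (iv3 (Int.sign x) (Int.sign y) 1)) j + s.1 * xiInd (code3 (iv3 (Int.sign x) (Int.sign y) (-1))) j +
    2 * s.2.1 * xiInd (code3 (iv3 (Int.sign x) (Int.sign y) 0)) j + 2 * s.2.2.2.1 * xiInd (code3 (dl1 x y)) j +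
    s.2.2.1 * xiInd (code3 (dl2 x y 1)) j + s.2.2.1 * xiInd (code3 (dl2 x y (-1))) j +
    s.2.2.2.2 * xiInd (code3 (iv3 0 0 1)) j + s.2.2.2.2 * xiInd (code3 (iv3 0 0 (-1))) j

/-- ★ `xiRowBins` READ: length `27` and `bins'[j] = bins[j] + xiRowAdd j`. [g99] -/
theorem xiRowBins_getD (K HI1 HI2 : ℕ) (x y : ℤ) (mA mB : ℕ) {bins : List ℕ} (hlen : bins.length = 27) :
    (xiRowBins K HI1 HI2 x y mA mB bins).length = 27 ∧
    ∀ j, (xiRowBins K HI1 HI2 x y mA mB bins).getD j 0 = bins.getD j 0 + xiRowAdd K HI1 HI2 x y mA mB j := by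
  have hsx := sign_mem x
  have hsy := sign_mem y
  have h11 : (-1 : ℤ) ≤ 1 ∧ (1 : ℤ) ≤ 1 := by omega
  have h00 : (-1 : ℤ) ≤ 0 ∧ (0 : ℤ) ≤ 1 := by omega
  have hmm : (-1 : ℤ) ≤ -1 ∧ (-1 : ℤ) ≤ 1 := by omega
  have hc1 : (if y.natAbs ≤ x.natAbs then xiDcode (Int.sign x) 0 0 else xiDcode 0 (Int.sign y) 0) < 27 := by
    split_ifs
    · exact xiDcode_lt hsx h00 h00
    · exact xiDcode_lt h00 hsy h00
  have hc2u : (if y.natAbs ≤ x.natAbs then xiDcode (Int.sign x) 0 1 else xiDcode 0 (Int.sign y) 1) < 27 := by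
    split_ifs
    · exact xiDcode_lt hsx h00 h11
    · exact xiDcode_lt h00 hsy h11
  have hc2d : (if y.natAbs ≤ x.natAbs then xiDcode (Int.sign x) 0 (-1) else xiDcode 0 (Int.sign y) (-1)) < 27 := by
    split_ifs
    · exact xiDcode_lt hsx h00 hmm
    · exact xiDcode_lt h00 hsy hmm
  have hc3u := xiDcode_lt hsx hsy h11
  have hc3d := xiDcode_lt hsx hsy hmm
  have hc2 := xiDcode_lt hsx hsy h00
  have hup : xiDcode 0 0 1 < 27 := xiDcode_lt h00 h00 h11
  have hdn : xiDcode 0 0 (-1) < 27 := xiDcode_lt h00 h00 hmm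
  -- the inner `bins0`
  have hb0 : ∀ (P : Prop) [Decidable P] (u v : ℕ),
      (if P then xiAddAt (xiAddAt bins (xiDcode (Int.sign x) (Int.sign y) 0) u)
        (if y.natAbs ≤ x.natAbs then xiDcode (Int.sign x) 0 0 else xiDcode 0 (Int.sign y) 0) v else bins).length = 27 ∧
      ∀ j, (if P then xiAddAt (xiAddAt bins (xiDcode (Int.sign x) (Int.sign y) 0) u)
        (if y.natAbs ≤ x.natAbs then xiDcode (Int.sign x) 0 0 else xiDcode 0 (Int.sign y) 0) v else bins).getD j 0 =
        bins.getD j 0 + if P then u * xiInd (code3 (iv3 (Int.sign x) (Int.sign y) 0)) j + v * xiInd (code3 (dl1 x y)) j else 0 := by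
    intro P _ u v
    by_cases hP : P
    · simp only [if_pos hP, length_xiAddAt, hlen, true_and]
      intro j
      rw [getD_xiAddAt' (by rw [length_xiAddAt, hlen]; exact hc1), getD_xiAddAt' (by rw [hlen]; exact hc2), code3_iv3, code3_dl1]
      ring
    · simp only [if_neg hP, hlen, add_zero, true_and]
      intro j; trivial
  obtain ⟨hl0, hg0⟩ := hb0 (HI1 < xiQ0 x y ∧ xiQ0 x y ≤ HI2 ∧ ¬(x = 0 ∧ y = 0))
    (min x.natAbs y.natAbs * ((K * max x.natAbs y.natAbs + xiQ0 x y ^ 4 - 1) / xiQ0 x y ^ 4))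
    ((max x.natAbs y.natAbs - min x.natAbs y.natAbs) * ((K * max x.natAbs y.natAbs + xiQ0 x y ^ 4 - 1) / xiQ0 x y ^ 4))
  constructor
  · simp only [xiRowBins, length_xiAddAt, hl0]
  · intro j
    simp only [xiRowBins, xiRowAdd, code3_iv3, code3_dl1, code3_dl2]
    rw [getD_xiAddAt' (by simp only [length_xiAddAt, hl0]; exact hdn), getD_xiAddAt' (by simp only [length_xiAddAt, hl0]; exact hup),
      getD_xiAddAt' (by simp only [length_xiAddAt, hl0]; exact hc2d), getD_xiAddAt' (by simp only [length_xiAddAt, hl0]; exact hc2u),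
      getD_xiAddAt' (by simp only [length_xiAddAt, hl0]; exact hc1), getD_xiAddAt' (by simp only [length_xiAddAt, hl0]; exact hc2),
      getD_xiAddAt' (by simp only [length_xiAddAt, hl0]; exact hc3d), getD_xiAddAt' (by rw [hl0]; exact hc3u),
      hg0 j]
    simp only [code3_iv3, code3_dl1]
    ring

/-- a member `(x, y, n)` with `n ≥ 1`: its weighted run count at bin `code3 δ` is at most its share of the row sums. [g99] -/
theorem member_bound_pos (K : ℕ) (x y : ℤ) (n : ℕ) (hn : 1 ≤ n) (δ : Cell 2 × ℤ) :
    kcnt (iv3 x y n) δ * xiCoef K (iv3 x y n) ≤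
      amt3 (min x.natAbs y.natAbs) n * xiC K (xiQmn x y) (max x.natAbs y.natAbs) n *
          xiInd (code3 (iv3 (Int.sign x) (Int.sign y) 1)) (code3 δ) +
        amt2 (min x.natAbs y.natAbs) n * xiC K (xiQmn x y) (max x.natAbs y.natAbs) n *
          xiInd (code3 (iv3 (Int.sign x) (Int.sign y) 0)) (code3 δ) +
        amt2v (min x.natAbs y.natAbs) (max x.natAbs y.natAbs) n * xiC K (xiQmn x y) (max x.natAbs y.natAbs) n *
          xiInd (code3 (dl2 x y 1)) (code3 δ) +
        amt1 (min x.natAbs y.natAbs) (max x.natAbs y.natAbs) n * xiC K (xiQmn x y) (max x.natAbs y.natAbs) n *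
          xiInd (code3 (dl1 x y)) (code3 δ) +
        amtv (min x.natAbs y.natAbs) (max x.natAbs y.natAbs) n * xiC K (xiQmn x y) (max x.natAbs y.natAbs) n *
          xiInd (code3 (iv3 0 0 1)) (code3 δ) := by
  have hn0 : (n : ℤ) ≠ 0 := by exact_mod_cast (show n ≠ 0 by omega)
  have hs : Int.sign (n : ℤ) = 1 := Int.sign_eq_one_of_pos (by exact_mod_cast hn)
  rw [xiCoef_iv3 K x y n hn0, kcnt_iv3, Int.natAbs_natCast, hs]
  have i1 := ite_le_xiInd (iv3 (Int.sign x) (Int.sign y) 1) δ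
  have i2 := ite_le_xiInd (iv3 (Int.sign x) (Int.sign y) 0) δ
  have i3 := ite_le_xiInd (dl2 x y 1) δ
  have i4 := ite_le_xiInd (dl1 x y) δ
  have i5 := ite_le_xiInd (iv3 0 0 1) δ
  nlinarith [Nat.zero_le (amt3 (min x.natAbs y.natAbs) n * xiC K (xiQmn x y) (max x.natAbs y.natAbs) n),
    Nat.zero_le (amt2 (min x.natAbs y.natAbs) n * xiC K (xiQmn x y) (max x.natAbs y.natAbs) n),
    Nat.zero_le (amt2v (min x.natAbs y.natAbs) (max x.natAbs y.natAbs) n * xiC K (xiQmn x y) (max x.natAbs y.natAbs) n),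
    Nat.zero_le (amt1 (min x.natAbs y.natAbs) (max x.natAbs y.natAbs) n * xiC K (xiQmn x y) (max x.natAbs y.natAbs) n),
    Nat.zero_le (amtv (min x.natAbs y.natAbs) (max x.natAbs y.natAbs) n * xiC K (xiQmn x y) (max x.natAbs y.natAbs) n),
    Nat.mul_le_mul_left (amt3 (min x.natAbs y.natAbs) n * xiC K (xiQmn x y) (max x.natAbs y.natAbs) n) i1,
    Nat.mul_le_mul_left (amt2 (min x.natAbs y.natAbs) n * xiC K (xiQmn x y) (max x.natAbs y.natAbs) n) i2,
    Nat.mul_le_mul_left (amt2v (min x.natAbs y.natAbs) (max x.natAbs y.natAbs) n * xiC K (xiQmn x y) (max x.natAbs y.natAbs) n) i3,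
    Nat.mul_le_mul_left (amt1 (min x.natAbs y.natAbs) (max x.natAbs y.natAbs) n * xiC K (xiQmn x y) (max x.natAbs y.natAbs) n) i4,
    Nat.mul_le_mul_left (amtv (min x.natAbs y.natAbs) (max x.natAbs y.natAbs) n * xiC K (xiQmn x y) (max x.natAbs y.natAbs) n) i5]

/-- a member `(x, y, −n)` with `n ≥ 1`. [g99] -/
theorem member_bound_neg (K : ℕ) (x y : ℤ) (n : ℕ) (hn : 1 ≤ n) (δ : Cell 2 × ℤ) :
    kcnt (iv3 x y (-(n : ℤ))) δ * xiCoef K (iv3 x y (-(n : ℤ))) ≤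
      amt3 (min x.natAbs y.natAbs) n * xiC K (xiQmn x y) (max x.natAbs y.natAbs) n *
          xiInd (code3 (iv3 (Int.sign x) (Int.sign y) (-1))) (code3 δ) +
        amt2 (min x.natAbs y.natAbs) n * xiC K (xiQmn x y) (max x.natAbs y.natAbs) n *
          xiInd (code3 (iv3 (Int.sign x) (Int.sign y) 0)) (code3 δ) +
        amt2v (min x.natAbs y.natAbs) (max x.natAbs y.natAbs) n * xiC K (xiQmn x y) (max x.natAbs y.natAbs) n *
          xiInd (code3 (dl2 x y (-1))) (code3 δ) +
        amt1 (min x.natAbs y.natAbs) (max x.natAbs y.natAbs) n * xiC K (xiQmn x y) (max x.natAbs y.natAbs) n *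
          xiInd (code3 (dl1 x y)) (code3 δ) +
        amtv (min x.natAbs y.natAbs) (max x.natAbs y.natAbs) n * xiC K (xiQmn x y) (max x.natAbs y.natAbs) n *
          xiInd (code3 (iv3 0 0 (-1))) (code3 δ) := by
  have hn0 : (-(n : ℤ)) ≠ 0 := by omega
  have hs : Int.sign (-(n : ℤ)) = -1 := Int.sign_eq_neg_one_of_neg (by omega)
  have ha : (-(n : ℤ)).natAbs = n := by rw [Int.natAbs_neg, Int.natAbs_natCast]
  rw [xiCoef_iv3 K x y _ hn0, kcnt_iv3, ha, hs]
  have i1 := ite_le_xiInd (iv3 (Int.sign x) (Int.sign y) (-1)) δ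
  have i2 := ite_le_xiInd (iv3 (Int.sign x) (Int.sign y) 0) δ
  have i3 := ite_le_xiInd (dl2 x y (-1)) δ
  have i4 := ite_le_xiInd (dl1 x y) δ
  have i5 := ite_le_xiInd (iv3 0 0 (-1)) δ
  nlinarith [Nat.zero_le (amt3 (min x.natAbs y.natAbs) n * xiC K (xiQmn x y) (max x.natAbs y.natAbs) n),
    Nat.zero_le (amt2 (min x.natAbs y.natAbs) n * xiC K (xiQmn x y) (max x.natAbs y.natAbs) n),
    Nat.zero_le (amt2v (min x.natAbs y.natAbs) (max x.natAbs y.natAbs) n * xiC K (xiQmn x y) (max x.natAbs y.natAbs) n),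
    Nat.zero_le (amt1 (min x.natAbs y.natAbs) (max x.natAbs y.natAbs) n * xiC K (xiQmn x y) (max x.natAbs y.natAbs) n),
    Nat.zero_le (amtv (min x.natAbs y.natAbs) (max x.natAbs y.natAbs) n * xiC K (xiQmn x y) (max x.natAbs y.natAbs) n),
    Nat.mul_le_mul_left (amt3 (min x.natAbs y.natAbs) n * xiC K (xiQmn x y) (max x.natAbs y.natAbs) n) i1,
    Nat.mul_le_mul_left (amt2 (min x.natAbs y.natAbs) n * xiC K (xiQmn x y) (max x.natAbs y.natAbs) n) i2,
    Nat.mul_le_mul_left (amt2v (min x.natAbs y.natAbs) (max x.natAbs y.natAbs) n * xiC K (xiQmn x y) (max x.natAbs y.natAbs) n) i3,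
    Nat.mul_le_mul_left (amt1 (min x.natAbs y.natAbs) (max x.natAbs y.natAbs) n * xiC K (xiQmn x y) (max x.natAbs y.natAbs) n) i4,
    Nat.mul_le_mul_left (amtv (min x.natAbs y.natAbs) (max x.natAbs y.natAbs) n * xiC K (xiQmn x y) (max x.natAbs y.natAbs) n) i5]

/-- the member `(x, y, 0)`. [g99] -/
theorem member_bound_zero (K : ℕ) (x y : ℤ) (δ : Cell 2 × ℤ) :
    kcnt (iv3 x y 0) δ * xiCoef K (iv3 x y 0) ≤
      min x.natAbs y.natAbs * ((K * max x.natAbs y.natAbs + xiQ0 x y ^ 4 - 1) / xiQ0 x y ^ 4) *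
          xiInd (code3 (iv3 (Int.sign x) (Int.sign y) 0)) (code3 δ) +
        (max x.natAbs y.natAbs - min x.natAbs y.natAbs) * ((K * max x.natAbs y.natAbs + xiQ0 x y ^ 4 - 1) / xiQ0 x y ^ 4) *
          xiInd (code3 (dl1 x y)) (code3 δ) := by
  rw [xiCoef_iv3_zero, kcnt_iv3]
  simp only [Int.natAbs_zero, Int.sign_zero, amt3, amt2, amt2v, amt1, amtv, Nat.zero_le, if_true, zero_mul, zero_add, add_zero,
    Nat.sub_zero]
  have i2 := ite_le_xiInd (iv3 (Int.sign x) (Int.sign y) 0) δ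
  have i4 := ite_le_xiInd (dl1 x y) δ
  nlinarith [Nat.zero_le (min x.natAbs y.natAbs * ((K * max x.natAbs y.natAbs + xiQ0 x y ^ 4 - 1) / xiQ0 x y ^ 4)),
    Nat.zero_le ((max x.natAbs y.natAbs - min x.natAbs y.natAbs) * ((K * max x.natAbs y.natAbs + xiQ0 x y ^ 4 - 1) / xiQ0 x y ^ 4)),
    Nat.mul_le_mul_left (min x.natAbs y.natAbs * ((K * max x.natAbs y.natAbs + xiQ0 x y ^ 4 - 1) / xiQ0 x y ^ 4)) i2,
    Nat.mul_le_mul_left ((max x.natAbs y.natAbs - min x.natAbs y.natAbs) * ((K * max x.natAbs y.natAbs + xiQ0 x y ^ 4 - 1) / xiQ0 x y ^ 4)) i4]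

/-- ★★ ROW SOUNDNESS: if the certificate of row `(x, y)` checks, the new bins have length `27` and, for every finite set `S` of members
of the row and every `δ`, `bins[code3 δ] + Σ_{m ∈ S} kcnt (x,y,m) δ · xiCoef (x,y,m) ≤ bins'[code3 δ]`. [g99] -/
theorem xiRowC_sound {K HI1 HI2 : ℕ} {x y : ℤ} {mA mB : ℕ} {bins bins' : List ℕ} (hlen : bins.length = 27)
    (h : xiRowC K HI1 HI2 x y mA mB bins = some bins') :
    bins'.length = 27 ∧ ∀ S : Finset ℤ, (∀ m ∈ S, xiMember HI1 HI2 (iv3 x y m)) → ∀ δ : Cell 2 × ℤ,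
      bins.getD (code3 δ) 0 + ∑ m ∈ S, kcnt (iv3 x y m) δ * xiCoef K (iv3 x y m) ≤ bins'.getD (code3 δ) 0 := by
  classical
  unfold xiRowC at h
  split_ifs at h with hcert
  obtain ⟨h1, -, h3, h4, -⟩ := hcert
  have hE : bins' = xiRowBins K HI1 HI2 x y mA mB bins := (Option.some.inj h).symm
  subst hE
  obtain ⟨hl, hg⟩ := xiRowBins_getD K HI1 HI2 x y mA mB hlen
  refine ⟨hl, fun S hS δ => ?_⟩
  rw [hg (code3 δ)]
  simp only [xiRowAdd]
  rw [xiRowSums_eq]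
  set p := min x.natAbs y.natAbs with hp
  set q := max x.natAbs y.natAbs with hq
  set len := mB + 1 - mA with hlen'
  set c0 := (K * q + xiQ0 x y ^ 4 - 1) / xiQ0 x y ^ 4 with hc0
  have hmem : ∀ m ∈ S, (m = 0 ∧ HI1 < xiQ0 x y ∧ xiQ0 x y ≤ HI2 ∧ ¬(x = 0 ∧ y = 0)) ∨ (m ≠ 0 ∧ mA ≤ m.natAbs ∧ m.natAbs ≤ mB) :=
    fun m hm => xiMember_row h1 h3 h4 (hS m hm)
  -- split the set
  have hsplit : ∑ m ∈ S, kcnt (iv3 x y m) δ * xiCoef K (iv3 x y m) =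
      ∑ m ∈ S.filter (fun m => m = 0), kcnt (iv3 x y m) δ * xiCoef K (iv3 x y m) +
      (∑ m ∈ (S.filter (fun m => ¬m = 0)).filter (fun m => 0 < m), kcnt (iv3 x y m) δ * xiCoef K (iv3 x y m) +
       ∑ m ∈ (S.filter (fun m => ¬m = 0)).filter (fun m => ¬0 < m), kcnt (iv3 x y m) δ * xiCoef K (iv3 x y m)) := by
    rw [Finset.sum_filter_add_sum_filter_not, Finset.sum_filter_add_sum_filter_not]
  -- the `m = 0` member
  have hZ : ∑ m ∈ S.filter (fun m => m = 0), kcnt (iv3 x y m) δ * xiCoef K (iv3 x y m) ≤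
      (if HI1 < xiQ0 x y ∧ xiQ0 x y ≤ HI2 ∧ ¬(x = 0 ∧ y = 0) then
        p * c0 * xiInd (code3 (iv3 (Int.sign x) (Int.sign y) 0)) (code3 δ) + (q - p) * c0 * xiInd (code3 (dl1 x y)) (code3 δ)
        else 0) := by
    by_cases h0 : (0 : ℤ) ∈ S
    · have hc : HI1 < xiQ0 x y ∧ xiQ0 x y ≤ HI2 ∧ ¬(x = 0 ∧ y = 0) := by
        rcases hmem 0 h0 with h | h
        · exact h.2
        · exact absurd rfl h.1
      have hs0 : S.filter (fun m => m = 0) = {0} := by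
        ext m
        simp only [Finset.mem_filter, Finset.mem_singleton]
        exact ⟨fun h => h.2, fun h => ⟨h ▸ h0, h⟩⟩
      rw [hs0, Finset.sum_singleton, if_pos hc]
      exact member_bound_zero K x y δ
    · have hs0 : S.filter (fun m => m = 0) = ∅ := by
        ext m
        simp only [Finset.mem_filter, Finset.notMem_empty, iff_false, not_and]
        exact fun hm h => h0 (h ▸ hm)
      rw [hs0, Finset.sum_empty]
      exact Nat.zero_le _
  -- the positive members
  have hP : ∑ m ∈ (S.filter (fun m => ¬m = 0)).filter (fun m => 0 < m), kcnt (iv3 x y m) δ * xiCoef K (iv3 x y m) ≤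
      ∑ i ∈ Finset.range len, kcnt (iv3 x y ((mA + i : ℕ) : ℤ)) δ * xiCoef K (iv3 x y ((mA + i : ℕ) : ℤ)) := by
    have hsub : (S.filter (fun m => ¬m = 0)).filter (fun m => 0 < m) ⊆ (Finset.range len).image (fun i => ((mA + i : ℕ) : ℤ)) := by
      intro m hm
      simp only [Finset.mem_filter] at hm
      rcases hmem m hm.1.1 with h | h
      · exact absurd h.1 hm.1.2
      · refine Finset.mem_image.mpr ⟨m.natAbs - mA, Finset.mem_range.mpr (by omega), ?_⟩
        omega
    calc _ ≤ ∑ m ∈ (Finset.range len).image (fun i => ((mA + i : ℕ) : ℤ)), kcnt (iv3 x y m) δ * xiCoef K (iv3 x y m) :=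
          Finset.sum_le_sum_of_subset_of_nonneg hsub (fun _ _ _ => Nat.zero_le _)
      _ = _ := Finset.sum_image (fun i _ j _ hij => by simp only [Nat.cast_inj] at hij; omega)
  -- the negative members
  have hN : ∑ m ∈ (S.filter (fun m => ¬m = 0)).filter (fun m => ¬0 < m), kcnt (iv3 x y m) δ * xiCoef K (iv3 x y m) ≤
      ∑ i ∈ Finset.range len, kcnt (iv3 x y (-((mA + i : ℕ) : ℤ))) δ * xiCoef K (iv3 x y (-((mA + i : ℕ) : ℤ))) := by
    have hsub : (S.filter (fun m => ¬m = 0)).filter (fun m => ¬0 < m) ⊆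
        (Finset.range len).image (fun i => -((mA + i : ℕ) : ℤ)) := by
      intro m hm
      simp only [Finset.mem_filter] at hm
      rcases hmem m hm.1.1 with h | h
      · exact absurd h.1 hm.1.2
      · refine Finset.mem_image.mpr ⟨m.natAbs - mA, Finset.mem_range.mpr (by omega), ?_⟩
        omega
    calc _ ≤ ∑ m ∈ (Finset.range len).image (fun i => -((mA + i : ℕ) : ℤ)), kcnt (iv3 x y m) δ * xiCoef K (iv3 x y m) :=
          Finset.sum_le_sum_of_subset_of_nonneg hsub (fun _ _ _ => Nat.zero_le _)
      _ = _ := Finset.sum_image (fun i _ j _ hij => by simp only [neg_inj, Nat.cast_inj] at hij; omega)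
  -- termwise bounds, summed and regrouped
  have hP' : ∑ i ∈ Finset.range len, kcnt (iv3 x y ((mA + i : ℕ) : ℤ)) δ * xiCoef K (iv3 x y ((mA + i : ℕ) : ℤ)) ≤
      (∑ i ∈ Finset.range len, amt3 p (mA + i) * xiC K (xiQmn x y) q (mA + i)) *
          xiInd (code3 (iv3 (Int.sign x) (Int.sign y) 1)) (code3 δ) +
        (∑ i ∈ Finset.range len, amt2 p (mA + i) * xiC K (xiQmn x y) q (mA + i)) *
          xiInd (code3 (iv3 (Int.sign x) (Int.sign y) 0)) (code3 δ) +
        (∑ i ∈ Finset.range len, amt2v p q (mA + i) * xiC K (xiQmn x y) q (mA + i)) * xiInd (code3 (dl2 x y 1)) (code3 δ) +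
        (∑ i ∈ Finset.range len, amt1 p q (mA + i) * xiC K (xiQmn x y) q (mA + i)) * xiInd (code3 (dl1 x y)) (code3 δ) +
        (∑ i ∈ Finset.range len, amtv p q (mA + i) * xiC K (xiQmn x y) q (mA + i)) * xiInd (code3 (iv3 0 0 1)) (code3 δ) := by
    rw [Finset.sum_mul, Finset.sum_mul, Finset.sum_mul, Finset.sum_mul, Finset.sum_mul, ← Finset.sum_add_distrib,
      ← Finset.sum_add_distrib, ← Finset.sum_add_distrib, ← Finset.sum_add_distrib]
    exact Finset.sum_le_sum fun i _ => member_bound_pos K x y (mA + i) (by omega) δ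
  have hN' : ∑ i ∈ Finset.range len, kcnt (iv3 x y (-((mA + i : ℕ) : ℤ))) δ * xiCoef K (iv3 x y (-((mA + i : ℕ) : ℤ))) ≤
      (∑ i ∈ Finset.range len, amt3 p (mA + i) * xiC K (xiQmn x y) q (mA + i)) *
          xiInd (code3 (iv3 (Int.sign x) (Int.sign y) (-1))) (code3 δ) +
        (∑ i ∈ Finset.range len, amt2 p (mA + i) * xiC K (xiQmn x y) q (mA + i)) *
          xiInd (code3 (iv3 (Int.sign x) (Int.sign y) 0)) (code3 δ) +
        (∑ i ∈ Finset.range len, amt2v p q (mA + i) * xiC K (xiQmn x y) q (mA + i)) * xiInd (code3 (dl2 x y (-1))) (code3 δ) +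
        (∑ i ∈ Finset.range len, amt1 p q (mA + i) * xiC K (xiQmn x y) q (mA + i)) * xiInd (code3 (dl1 x y)) (code3 δ) +
        (∑ i ∈ Finset.range len, amtv p q (mA + i) * xiC K (xiQmn x y) q (mA + i)) * xiInd (code3 (iv3 0 0 (-1))) (code3 δ) := by
    rw [Finset.sum_mul, Finset.sum_mul, Finset.sum_mul, Finset.sum_mul, Finset.sum_mul, ← Finset.sum_add_distrib,
      ← Finset.sum_add_distrib, ← Finset.sum_add_distrib, ← Finset.sum_add_distrib]
    exact Finset.sum_le_sum fun i _ => member_bound_neg K x y (mA + i) (by omega) δ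
  rw [hsplit]
  linarith [hZ, hP, hN, hP', hN']

end Summit.AtomisticToContinuum.Crystallization.Theorems.ChartedZeroExcessLayeredLatticeLiouville
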